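import Literature.AlgebraicGeometry.HodgeTheory.AbelianVarietyStableSubvarietiesClassification
import Literature.AlgebraicGeometry.HodgeTheory.AbelianVarietySimpleSubvarietiesCount
import HarnessLib

/-!
# The lattice of `End X`-stable abelian subvarieties is the Boolean lattice of subsets of the isotypic types, and it is an
# isogeny invariant (Mumford §19 Cor. 1–2; Silverberg–Zarhin 2015 Def. 2.2–2.3; Lam §22 Prop. (22.1))

Layer `Literature/AlgebraicGeometry/HodgeTheory`; theorems only (no `def`, no instance, no named fact; net debt 0).  Sequel of
`HodgeTheory/AbelianVarietyStableSubvarietiesClassification` (the `End X`-stable abelian subvarieties of `X` are exactly the sums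
`Σ_{q ∈ S} Y_q` of isotypic components).  Here the ORDER: `Σ_{q ∈ S} Y_q ⊆ Σ_{q ∈ T} Y_q` iff `S ⊆ T` (any field, for a system of
abelian subvarieties `i_q : Y_q ↪ X` of positive dimension whose addition map is an isogeny), so `S ↦ Σ_{q ∈ S} Y_q` is an ORDER
ISOMORPHISM from the Boolean lattice `Finset Q` onto the `End X`-stable abelian subvarieties ordered by inclusion of closed subsets;
the components inside `Σ_{q ∈ S} Y_q` are the `Y_q`, `q ∈ S`, and the stable abelian subvarieties inside a component `Y_q` are `0` and
`Y_q`.  Over a perfect field every `X` has such a system, the lattice is `≃o Finset (Fin r)` with `2^r = #{central idempotents of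
End⁰ X}`, and since `End⁰ X ≅ End⁰ X'` for `X ∼ X'` the lattices of `End`-stable abelian subvarieties of ISOGENOUS abelian varieties
are order-isomorphic (in particular equinumerous).

THE PRINT.  Mumford, *Abelian Varieties* §19 Cor. 1–2 of Thm. 1 (pp. 173–174); Silverberg–Zarhin 2015 Def. 2.2–2.3 (p. 3) and
Lemma 3.1 (p. 5); Lam, *A First Course in Noncommutative Rings* §22 Prop. (22.1) (p. 326: the central idempotents of a ring with
`r` blocks form the Boolean algebra of the `2^r` sub-sums); Zarhin 2008 Thm. 3.2 and §5 (pp. 7, 9).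

Results (namespace `Literature.AlgebraicGeometry.HodgeTheory.AbelianVariety`):
* §1 (any field) `range_biproduct_desc_mono`, **`range_component_subset_range_biproduct_desc_iff`** (`Y_q ⊆ Σ_T Y` iff `q ∈ T`),
  **`range_biproduct_desc_subset_iff`** (`Σ_S ⊆ Σ_T` iff `S ⊆ T`), `range_biproduct_desc_ssubset_iff`, `range_biproduct_desc_eq_iff`,
  `range_biproduct_desc_subset_range_component_iff` (`Σ_S ⊆ Y_q` iff `S ⊆ {q}`),
  **`exists_orderIso_finset_stable_of_components`** (`S ↦ Σ_S Y_q : Finset Q ≃o {End X-stable abelian subvarieties}`),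
  `forall_stable_subset_component_iff` (the stable abelian subvarieties inside `Y_q` are `Σ_∅` and `Y_q`);
* §2 (any field) `ncard_setOf_central_idempotent_endAlgebra_eq_of_isIsogenous`;
* §3 (perfect field, every `X`) **`exists_orderIso_finset_stable`** (`{End X-stable} ≃o Finset (Fin r)`, `2^r` central idempotents),
  **`nonempty_orderIso_stable_of_isIsogenous`** (isogenous abelian varieties have order-isomorphic lattices of `End`-stable
  abelian subvarieties), `natCard_setOf_range_stable_subvariety_eq_of_isIsogenous`.

## References
* [MumfordAV1970] D. Mumford, *Abelian Varieties* (1970), §19 Thm. 1, Cor. 1–2 (pp. 173–174).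
* [SilverbergZarhin2015] A. Silverberg, Yu. G. Zarhin, *Isogenies of abelian varieties over finite fields* (2015)
  (arXiv:1409.0592), Def. 2.2–2.3 (p. 3), Lemma 3.1 (p. 5).
* [Lam2001FirstCourse] T. Y. Lam, *A First Course in Noncommutative Rings*, 2nd ed. (2001), §22 Prop. (22.1) p. 326.
* [Zarhin2008HomomorphismsFiniteFields] Yu. G. Zarhin, *Homomorphisms of abelian varieties over finite fields* (2008)
  (arXiv:0711.1615), Thm. 3.2 and §5 (pp. 7, 9).
-/

noncomputable section

universe u

open CategoryTheory CategoryTheory.Limits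

namespace Literature.AlgebraicGeometry.HodgeTheory

namespace AbelianVariety

open _root_.AlgebraicGeometry
open Literature.AlgebraicGeometry.Motives Literature.AlgebraicGeometry.Motives.AbelianVariety
open Literature.RingTheory.Idempotents

variable {K : Type u} [Field K]

/-! ## §1 The order: `Σ_S Y_q ⊆ Σ_T Y_q` iff `S ⊆ T` (any field) -/

section AnyField

variable {X : Motives.AbelianVariety K} {Q : Type} [Fintype Q] {Y B : Q → Motives.AbelianVariety K} {n : Q → ℕ}
  (i : ∀ q, Y q ⟶ X) {v : X ⟶ ⨁ Y} {m : ℕ}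

/-- `S ⊆ T` gives `Σ_{q ∈ S} Y_q ⊆ Σ_{q ∈ T} Y_q` (the smaller sum factors through the larger). [cite: MumfordAV1970, §19 Thm. 1 (p. 173)] -/
theorem range_biproduct_desc_mono {S T : Finset Q} (h : S ⊆ T) :
    Set.range (Hom.toSchemeHom (biproduct.desc fun s : S ↦ i s)) ⊆ Set.range (Hom.toSchemeHom (biproduct.desc fun t : T ↦ i t)) := by
  classical
  have hfac : (biproduct.desc fun s : S ↦ i s) =
      (biproduct.desc fun s : S ↦ biproduct.ι (fun t : T ↦ Y t) ⟨s, h s.2⟩) ≫ biproduct.desc fun t : T ↦ i t :=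
    biproduct.hom_ext' _ _ fun s ↦ by rw [biproduct.ι_desc, biproduct.ι_desc_assoc, biproduct.ι_desc]
  rw [hfac]
  exact range_toSchemeHom_comp_subset _ _

/-- **`Y_q ⊆ Σ_{t ∈ T} Y_t` IFF `q ∈ T`** (any field; addition map an isogeny with quasi-inverse `v`, all `dim Y_q > 0`).
[cite: MumfordAV1970, §19 Cor. 1 of Thm. 1 (p. 173)] [cite: SilverbergZarhin2015, Def. 2.2–2.3 (p. 3)] -/
theorem range_component_subset_range_biproduct_desc_iff (hi : ∀ q, IsClosedImmersion (Hom.toSchemeHom (i q)))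
    (hdv : biproduct.desc i ≫ v = m • 𝟙 (⨁ Y)) (hvd : v ≫ biproduct.desc i = m • 𝟙 X) (hm : m ≠ 0)
    (hY0 : ∀ q, 0 < (Y q).dim) {q : Q} {T : Finset Q} :
    Set.range (Hom.toSchemeHom (i q)) ⊆ Set.range (Hom.toSchemeHom (biproduct.desc fun t : T ↦ i t)) ↔ q ∈ T := by
  refine ⟨mem_of_range_component_subset_range_biproduct_desc i hi hdv hvd hm hY0, fun hq ↦ ?_⟩
  rw [← range_biproduct_desc_singleton i q]
  exact range_biproduct_desc_mono i (Finset.singleton_subset_iff.2 hq)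

/-- **`Σ_{q ∈ S} Y_q ⊆ Σ_{q ∈ T} Y_q` IFF `S ⊆ T`** (any field). [cite: MumfordAV1970, §19 Cor. 1 of Thm. 1 (p. 173)]
[cite: SilverbergZarhin2015, Def. 2.2–2.3 (p. 3)] -/
theorem range_biproduct_desc_subset_iff (hi : ∀ q, IsClosedImmersion (Hom.toSchemeHom (i q)))
    (hdv : biproduct.desc i ≫ v = m • 𝟙 (⨁ Y)) (hvd : v ≫ biproduct.desc i = m • 𝟙 X) (hm : m ≠ 0)
    (hY0 : ∀ q, 0 < (Y q).dim) {S T : Finset Q} :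
    Set.range (Hom.toSchemeHom (biproduct.desc fun s : S ↦ i s)) ⊆ Set.range (Hom.toSchemeHom (biproduct.desc fun t : T ↦ i t)) ↔
      S ⊆ T := by
  refine ⟨fun h q hq ↦ ?_, range_biproduct_desc_mono i⟩
  exact (range_component_subset_range_biproduct_desc_iff i hi hdv hvd hm hY0).1
    (((range_component_subset_range_biproduct_desc_iff i hi hdv hvd hm hY0).2 hq).trans h)

/-- `Σ_S Y_q = Σ_T Y_q` iff `S = T` (any field). [cite: MumfordAV1970, §19 Cor. 1 of Thm. 1 (p. 173)] -/
theorem range_biproduct_desc_eq_iff (hi : ∀ q, IsClosedImmersion (Hom.toSchemeHom (i q)))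
    (hdv : biproduct.desc i ≫ v = m • 𝟙 (⨁ Y)) (hvd : v ≫ biproduct.desc i = m • 𝟙 X) (hm : m ≠ 0)
    (hY0 : ∀ q, 0 < (Y q).dim) {S T : Finset Q} :
    Set.range (Hom.toSchemeHom (biproduct.desc fun s : S ↦ i s)) = Set.range (Hom.toSchemeHom (biproduct.desc fun t : T ↦ i t)) ↔
      S = T := by
  rw [Set.Subset.antisymm_iff, Finset.Subset.antisymm_iff, range_biproduct_desc_subset_iff i hi hdv hvd hm hY0,
    range_biproduct_desc_subset_iff i hi hdv hvd hm hY0]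

/-- `Σ_S Y_q ⊂ Σ_T Y_q` iff `S ⊂ T` (any field). [cite: MumfordAV1970, §19 Cor. 1 of Thm. 1 (p. 173)] -/
theorem range_biproduct_desc_ssubset_iff (hi : ∀ q, IsClosedImmersion (Hom.toSchemeHom (i q)))
    (hdv : biproduct.desc i ≫ v = m • 𝟙 (⨁ Y)) (hvd : v ≫ biproduct.desc i = m • 𝟙 X) (hm : m ≠ 0)
    (hY0 : ∀ q, 0 < (Y q).dim) {S T : Finset Q} :
    Set.range (Hom.toSchemeHom (biproduct.desc fun s : S ↦ i s)) ⊂ Set.range (Hom.toSchemeHom (biproduct.desc fun t : T ↦ i t)) ↔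
      S ⊂ T := by
  rw [Set.ssubset_iff_subset_ne, Finset.ssubset_iff_subset_ne, range_biproduct_desc_subset_iff i hi hdv hvd hm hY0, Ne,
    range_biproduct_desc_eq_iff i hi hdv hvd hm hY0]

/-- `Σ_S Y_q ⊆ Y_q₀` iff `S ⊆ {q₀}` (any field). [cite: MumfordAV1970, §19 Cor. 1 of Thm. 1 (p. 173)] -/
theorem range_biproduct_desc_subset_range_component_iff (hi : ∀ q, IsClosedImmersion (Hom.toSchemeHom (i q)))
    (hdv : biproduct.desc i ≫ v = m • 𝟙 (⨁ Y)) (hvd : v ≫ biproduct.desc i = m • 𝟙 X) (hm : m ≠ 0)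
    (hY0 : ∀ q, 0 < (Y q).dim) {S : Finset Q} {q : Q} :
    Set.range (Hom.toSchemeHom (biproduct.desc fun s : S ↦ i s)) ⊆ Set.range (Hom.toSchemeHom (i q)) ↔ S ⊆ {q} := by
  rw [← range_biproduct_desc_singleton i q, range_biproduct_desc_subset_iff i hi hdv hvd hm hY0]

/-- **`S ↦ Σ_{q ∈ S} Y_q` IS AN ORDER ISOMORPHISM FROM THE BOOLEAN LATTICE `Finset Q` ONTO THE `End X`-STABLE ABELIAN SUBVARIETIES**
ordered by inclusion (any field; `Hom`-orthogonal system `i_q : Y_q ↪ X`, addition map an isogeny, `Y_q ∼ B_q^{n_q+1}` with `B_q`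
simple of positive dimension). [cite: MumfordAV1970, §19 Cor. 1–2 of Thm. 1 (pp. 173–174)] [cite: Lam2001FirstCourse, §22 Prop. (22.1) p. 326]
[cite: SilverbergZarhin2015, Def. 2.2–2.3 (p. 3) and Lemma 3.1 (p. 5)] -/
theorem exists_orderIso_finset_stable_of_components (hi : ∀ q, IsClosedImmersion (Hom.toSchemeHom (i q)))
    (hdesc : IsIsogeny (biproduct.desc i)) (horth : ∀ q q', q ≠ q' → ∀ f : Y q ⟶ Y q', f = 0) (hB : ∀ q, (B q).IsSimple)
    (hB0 : ∀ q, 0 < (B q).dim) (hY : ∀ q, IsIsogenous (Y q) (⨁ fun _ : Fin (n q + 1) ↦ B q)) :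
    ∃ Φ : Finset Q ≃o
        {R : Set X.X.left | ∃ (Z : Motives.AbelianVariety K) (j : Z ⟶ X), IsClosedImmersion (Hom.toSchemeHom j) ∧
          R = Set.range (Hom.toSchemeHom j) ∧ ∀ φ : X ⟶ X, Set.range (Hom.toSchemeHom (j ≫ φ)) ⊆ Set.range (Hom.toSchemeHom j)},
      ∀ S : Finset Q, ((Φ S : {R : Set X.X.left | ∃ (Z : Motives.AbelianVariety K) (j : Z ⟶ X),
          IsClosedImmersion (Hom.toSchemeHom j) ∧ R = Set.range (Hom.toSchemeHom j) ∧
            ∀ φ : X ⟶ X, Set.range (Hom.toSchemeHom (j ≫ φ)) ⊆ Set.range (Hom.toSchemeHom j)}) : Set X.X.left) =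
        Set.range (Hom.toSchemeHom (biproduct.desc fun s : S ↦ i s)) := by
  classical
  obtain ⟨v, m, hm, hdv, hvd⟩ := IsIsogeny.exists_nsmul_inverse_holds hdesc
  have hY0 : ∀ q, 0 < (Y q).dim := fun q ↦ by
    rw [dim_eq_mul_of_isIsogenous_biproduct_const (hY q)]
    exact Nat.mul_pos (Nat.succ_pos _) (hB0 q)
  have hset := setOf_range_stable_subvariety_eq_range i hdesc horth hB hY
  let f : Finset Q → {R : Set X.X.left | ∃ (Z : Motives.AbelianVariety K) (j : Z ⟶ X), IsClosedImmersion (Hom.toSchemeHom j) ∧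
      R = Set.range (Hom.toSchemeHom j) ∧ ∀ φ : X ⟶ X, Set.range (Hom.toSchemeHom (j ≫ φ)) ⊆ Set.range (Hom.toSchemeHom j)} :=
    fun S ↦ ⟨Set.range (Hom.toSchemeHom (biproduct.desc fun s : S ↦ i s)), by rw [hset]; exact ⟨S, rfl⟩⟩
  let F := OrderEmbedding.ofMapLEIff f fun S T ↦ range_biproduct_desc_subset_iff i hi hdv hvd hm.ne' hY0
  have hsurj : Function.Surjective F := by
    rintro ⟨R, hR⟩
    rw [hset] at hR
    obtain ⟨S, rfl⟩ := hR
    exact ⟨S, rfl⟩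
  exact ⟨OrderIso.ofSurjective F hsurj, fun S ↦ rfl⟩

/-- **THE `End X`-STABLE ABELIAN SUBVARIETIES INSIDE A COMPONENT `Y_q` ARE `Σ_∅` AND `Y_q`** (any field; hypotheses as above).
[cite: SilverbergZarhin2015, Def. 2.2–2.3 (p. 3: isotypic components)] [cite: MumfordAV1970, §19 Cor. 1–2 of Thm. 1 (pp. 173–174)] -/
theorem forall_stable_subset_component_iff (hi : ∀ q, IsClosedImmersion (Hom.toSchemeHom (i q)))
    (hdesc : IsIsogeny (biproduct.desc i)) (hB : ∀ q, (B q).IsSimple) (hB0 : ∀ q, 0 < (B q).dim) (hY : ∀ q, IsIsogenous (Y q) (⨁ fun _ : Fin (n q + 1) ↦ B q)) {Z : Motives.AbelianVariety K}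
    (j : Z ⟶ X) [IsClosedImmersion (Hom.toSchemeHom j)]
    (hstab : ∀ φ : X ⟶ X, Set.range (Hom.toSchemeHom (j ≫ φ)) ⊆ Set.range (Hom.toSchemeHom j)) (q : Q) :
    Set.range (Hom.toSchemeHom j) ⊆ Set.range (Hom.toSchemeHom (i q)) ↔
      Set.range (Hom.toSchemeHom j) = Set.range (Hom.toSchemeHom (biproduct.desc fun s : (∅ : Finset Q) ↦ i s)) ∨
        Set.range (Hom.toSchemeHom j) = Set.range (Hom.toSchemeHom (i q)) := by
  classical
  obtain ⟨v, m, hm, hdv, hvd⟩ := IsIsogeny.exists_nsmul_inverse_holds hdesc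
  have hY0 : ∀ q, 0 < (Y q).dim := fun q ↦ by
    rw [dim_eq_mul_of_isIsogenous_biproduct_const (hY q)]
    exact Nat.mul_pos (Nat.succ_pos _) (hB0 q)
  obtain ⟨S, hS⟩ := exists_range_eq_range_biproduct_desc_of_forall_range_comp_subset i j hdv hvd hm.ne' hB hY hstab
  rw [hS, range_biproduct_desc_subset_range_component_iff i hi hdv hvd hm.ne' hY0, ← range_biproduct_desc_singleton i q,
    range_biproduct_desc_eq_iff i hi hdv hvd hm.ne' hY0, range_biproduct_desc_eq_iff i hi hdv hvd hm.ne' hY0,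
    Finset.subset_singleton_iff]

end AnyField

/-! ## §2 Isogeny invariance of the central idempotents (any field) -/

section Isogeny

variable {X X' : Motives.AbelianVariety K}

/-- Isogenous abelian varieties have the same number of central idempotents in `End⁰` (`End⁰ X ≅ End⁰ X'`).
[cite: MumfordAV1970, §19 Cor. 2 of Thm. 1 (p. 174) and Remark p. 169] [cite: Lam2001FirstCourse, §22 Prop. (22.1) p. 326] -/
theorem ncard_setOf_central_idempotent_endAlgebra_eq_of_isIsogenous (h : IsIsogenous X X') :
    {z : X.endAlgebra | IsIdempotentElem z ∧ ∀ a, z * a = a * z}.ncard =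
      {z : X'.endAlgebra | IsIdempotentElem z ∧ ∀ a, z * a = a * z}.ncard := by
  obtain ⟨e⟩ := h.nonempty_endAlgebra_algEquiv
  exact (ncard_setOf_central_idempotent_congr e.toRingEquiv).symm

end Isogeny

/-! ## §3 Every abelian variety over a perfect field -/

section Perfect

variable [PerfectField K] (X : Motives.AbelianVariety K) {X' : Motives.AbelianVariety K}

/-- **THE `End X`-STABLE ABELIAN SUBVARIETIES FORM A BOOLEAN LATTICE `≃o Finset (Fin r)` WITH `2^r = #{central idempotents of End⁰ X}`**
(every abelian variety over a perfect field; `r` = number of isotypic components). [cite: MumfordAV1970, §19 Cor. 1–2 of Thm. 1 (pp. 173–174)]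
[cite: Lam2001FirstCourse, §22 Prop. (22.1) p. 326] -/
theorem exists_orderIso_finset_stable :
    ∃ r : ℕ, {z : X.endAlgebra | IsIdempotentElem z ∧ ∀ a, z * a = a * z}.ncard = 2 ^ r ∧
      Nonempty (Finset (Fin r) ≃o
        {R : Set X.X.left | ∃ (Z : Motives.AbelianVariety K) (j : Z ⟶ X), IsClosedImmersion (Hom.toSchemeHom j) ∧
          R = Set.range (Hom.toSchemeHom j) ∧ ∀ φ : X ⟶ X, Set.range (Hom.toSchemeHom (j ≫ φ)) ⊆ Set.range (Hom.toSchemeHom j)}) := by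
  obtain ⟨r, B, n, Y, i, hB, hB0, hni, hi, hY, -, hdesc, horth⟩ := exists_isotypicComponents_orthogonal X
  obtain ⟨Φ, -⟩ := exists_orderIso_finset_stable_of_components i hi hdesc horth hB hB0 hY
  exact ⟨r, by rw [ncard_setOf_central_idempotent_endAlgebra_eq_two_pow hB hB0 hni hY i hi hdesc, Fintype.card_fin], ⟨Φ⟩⟩

variable {X} in
/-- **ISOGENOUS ABELIAN VARIETIES HAVE ORDER-ISOMORPHIC LATTICES OF `End`-STABLE ABELIAN SUBVARIETIES** (perfect field): both are
`≃o Finset (Fin r)` with `2^r` the common number of central idempotents of `End⁰ X ≅ End⁰ X'`.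
[cite: MumfordAV1970, §19 Cor. 1–2 of Thm. 1 (pp. 173–174) and Remark p. 169] [cite: Lam2001FirstCourse, §22 Prop. (22.1) p. 326] -/
theorem nonempty_orderIso_stable_of_isIsogenous (h : IsIsogenous X X') :
    Nonempty ({R : Set X.X.left | ∃ (Z : Motives.AbelianVariety K) (j : Z ⟶ X), IsClosedImmersion (Hom.toSchemeHom j) ∧
          R = Set.range (Hom.toSchemeHom j) ∧ ∀ φ : X ⟶ X, Set.range (Hom.toSchemeHom (j ≫ φ)) ⊆ Set.range (Hom.toSchemeHom j)} ≃o
      {R : Set X'.X.left | ∃ (Z : Motives.AbelianVariety K) (j : Z ⟶ X'), IsClosedImmersion (Hom.toSchemeHom j) ∧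
          R = Set.range (Hom.toSchemeHom j) ∧ ∀ φ : X' ⟶ X', Set.range (Hom.toSchemeHom (j ≫ φ)) ⊆ Set.range (Hom.toSchemeHom j)}) := by
  obtain ⟨r, hr, ⟨Φ⟩⟩ := exists_orderIso_finset_stable X
  obtain ⟨r', hr', ⟨Φ'⟩⟩ := exists_orderIso_finset_stable X'
  have hrr : r = r' := Nat.pow_right_injective (le_refl 2)
    (by simp only; rw [← hr, ← hr', ncard_setOf_central_idempotent_endAlgebra_eq_of_isIsogenous h])
  subst hrr
  exact ⟨Φ.symm.trans Φ'⟩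

variable {X} in
/-- Isogenous abelian varieties have the same number of `End`-stable abelian subvarieties (perfect field).
[cite: MumfordAV1970, §19 Cor. 1–2 of Thm. 1 (pp. 173–174)] [cite: Zarhin2008HomomorphismsFiniteFields, Thm. 3.2 and §5 (pp. 7, 9)] -/
theorem natCard_setOf_range_stable_subvariety_eq_of_isIsogenous (h : IsIsogenous X X') :
    Nat.card {R : Set X.X.left | ∃ (Z : Motives.AbelianVariety K) (j : Z ⟶ X), IsClosedImmersion (Hom.toSchemeHom j) ∧
        R = Set.range (Hom.toSchemeHom j) ∧ ∀ φ : X ⟶ X, Set.range (Hom.toSchemeHom (j ≫ φ)) ⊆ Set.range (Hom.toSchemeHom j)} =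
      Nat.card {R : Set X'.X.left | ∃ (Z : Motives.AbelianVariety K) (j : Z ⟶ X'), IsClosedImmersion (Hom.toSchemeHom j) ∧
        R = Set.range (Hom.toSchemeHom j) ∧ ∀ φ : X' ⟶ X', Set.range (Hom.toSchemeHom (j ≫ φ)) ⊆ Set.range (Hom.toSchemeHom j)} := by
  rw [natCard_setOf_range_stable_subvariety_eq_ncard_central_idempotents X,
    natCard_setOf_range_stable_subvariety_eq_ncard_central_idempotents X', ncard_setOf_central_idempotent_endAlgebra_eq_of_isIsogenous h]

end Perfect

end AbelianVariety

end Literature.AlgebraicGeometry.HodgeTheory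

end
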